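import Summits.QuantumFields.YangMills.Theses.LangevinControlUV
import Summits.QuantumFields.YangMills.Theorems.HypercubicLimit.Negative.AllTimesGapFalse
import Summits.QuantumFields.YangMills.Theorems.LatticeGapInUVUnits.Negative.WeakCouplingConcentration
import Summits.QuantumFields.YangMills.Theorems.LatticeGapInUVUnits.Negative.UniformConstantFalse
import Literature.MathematicalPhysics.QuantumLattice.TorusWilsonMarkov
import Summits.QuantumFields.YangMills.Theorems.LangevinControlUVLatticeGapInUVUnitsSlabToDecay
import Summits.QuantumFields.YangMills.Theorems.LangevinControlUVLatticeGapInUVUnitsDecayToClustering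
import Summits.QuantumFields.YangMills.Theorems.LangevinControlUVLatticeGapInUVUnitsGaugeReduction

/-!
# Line `femto-slab-nondegeneracy` — skeleton for crux `LatticeGapInUVUnits` (stmt-QuantumFields-9366)

Crux (route `LangevinControlUV`, rev 7, item 9366, rank 5 — the IMPORTED infrared leg):
`Summit.QuantumFields.YangMills.Theses.LangevinControlUV.LatticeGapInUVUnits`, literally
`∀ G (compact simple) r a, Package r a → Concl r a` (§0 `crux_iff`): for every unit map `a` carrying the femto
two-point package, all pairs of gauge-invariant local observables cluster on all symmetric tori `(2S+1)⁴`,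
`S ≥ S₁(β)`, `n ≤ S`, at rate `c₁ · a(β)` per lattice step, per-pair constants uniform in `β` and `S`.

Idea card `Cruxes/LatticeGapInUVUnits/Ideas/femto-slab-nondegeneracy.md` (ideator 2). Panel: TRIAGE-r1-1 pass
("state C⁺ in the one-face OR two-face form deliberately; if two-face, name it a DS-type slab-decoupling
certificate and drop ⟺ OneScale"), r1-2 pass (T1: on the SYMMETRIC torus the card's "two exact lines" are thermal
traces; transfer data + trace formula + thermal-remainder stub needed; D1 `wilsonTorusTransferData` unsatisfiable as
an `IsOSRealisation`), r1-3 pass (E4 thermal multiplicity; record `K ≥ 1`; fold in one-ruler's adapters).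

## THE LINE (torus-native: the panel's T1/E4 objection is designed away, not stubbed)

The LEVER is the card's, in the two-face form and stated deliberately for every closed time-slab (§1
`SlabInequality`): at coupling `β`, on the torus `(2S+1)⁴`, freezing every link at time-distance `≥ D(β)` from the
support of a bounded slab observable `F` must RETAIN the fraction `1/K` of its variance,
`Var_μ F ≤ K · ∫ (F − μ[F | links at base-time distance ≥ D from the slab])² dμ`, with `D(β) = ⌈Θ/a(β)⌉` the femto
ruler of the hypothesis and `K, Θ` uniform in `β`, `S`, position and width of the slab (stub S1, the physics).
Equivalently: the `L²(μ)`-maximal-correlation (Kolmogorov–Rozanov ρ-mixing) coefficient between the slab σ-algebra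
and the exterior σ-algebra at time-distance `D(β)` is `≤ √(1 − 1/K) < 1` — NON-DEGENERACY at ONE physical thickness,
not smallness.

What changes w.r.t. the card is the ADAPTER, and this is the answer to T1/E4: the card's Hilbert-space "two exact
lines + spectral Jensen" (`½E(f_D − f_0)² = ⟪v,(1−T^D)v⟫`, `hasTransferGap_of_pow_form_bound`) are replaced by their
measure-theoretic twins ON `μ_{β,(2S+1)⁴}` ITSELF:
(i) law of total variance `Var(μ[F|𝓕]) = Var F − ∫(F − μ[F|𝓕])²` (so the slab inequality reads
`Var(μ[F | ext_D]) ≤ (1 − 1/K) · Var F`), and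
(ii) the TOWER PROPERTY along the nested exteriors `ext_D ⊇ ext_{2D} ⊇ …` of one slab plus the MARKOV PROPERTY of the
plaquette interaction (tree `TorusWilsonMarkov.condExp_wilsonMeasure_markov_slab`, `TorusWilsonGibbs.
isGibbsMeasure_wilsonMeasure` / `stronglyMeasurable_and_ae_eq_condExp_integral_gibbsSpecOfPotential`: the iterate
`μ[F | ext_{jD}]` is again a closed-slab observable, of the `jD`-enlarged slab) give
`Var(μ[F | ext_{jD}]) ≤ (1 − 1/K)^j · Var F` (stub S2), whence for local `A`, `B` and `B` translated by `n` in time,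
`|Cov(A, τ_n B)| = |Cov(μ[A | ext_{jD}], τ_n B)| ≤ (1−1/K)^{j/2} σ_A σ_B` with `j = ⌊(n − c_{AB})/D⌋` (stub S3):
decay rate `−log(1−1/K)/(2D) ≥ 1/(2KD)` per lattice step, i.e. with `D = ⌈Θ/a(β)⌉ ≤ 2Θ/a(β)` the crux's `c₁ · a(β)`
with `c₁ = κ(K)/(2Θ)` — the SAME dimensional bookkeeping as the card (`1/(2KΘℓ₀)`-type constant, sharp in `D`, no
factor `β`, no propagation speed), but with NO
transfer operator, NO thermal trace, NO OS realisation (definition request D1 dropped), NO positivity of `T` and NO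
spectral theorem: submultiplicativity of ρ-mixing for a Markov field replaces spectral Jensen. The thermal-remainder
/ multiplicity stub T1/E4 does not arise because nothing is ever conditioned "on one side" of a periodic time.

## Stubs (`lean check` rc 0; after the landings the only sorries are S0 `stub_rulerReduction` and S1' `stub_femtoSlabGI`)

* S0 `stub_rulerReduction : RulerReduction` — THE TYPED-`∀a` SOCKET, VERBATIM the sibling lines'
  (`KnabeBlockSampler.RulerReduction`, `OneRuler.RulerReduction`): every package ruler is eventually dominated by a
  CONTINUOUS package ruler. Identity on continuous rulers (`rulerReduction_of_continuous`); false under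
  `StandardScalingSU` exactly as the crux is (`not_rulerReduction_of_not_crux` with the landed negative lemma
  `Negative.latticeGapInUVUnits_false_of_standardScalingSU`). DO NOT STAFF; moot once 9366 is restated as C′
  (`cruxRepaired_of_stubs` needs no S0).
* S1 `FemtoSlabStub` — THE PHYSICS (hardest, open): for compact simple `G`, faithful `r`, CONTINUOUS
  package ruler `a`: `∃ Θ > 0, K ≥ 1, β₂, S₁(·)` with `SlabInequality r β S ⌈Θ/a β⌉ K` for all `β ≥ β₂`, `S ≥ S₁ β`.
  RESHAPED by Elitzur (lead c1) into the two registered stubs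
  S1' `stub_femtoSlabGI : FemtoSlabStubGI` (the same with the slab inequality asked only of GAUGE-INVARIANT closed-slab
  observables — the physics residue, OPEN, crux-sized) and
  S1r `stub_gaugeReduction` (gauge-invariant slab inequality ⇒ slab inequality for margins `D ≥ 2`, same `K`; LANDED
  p104023, `Theorems/LangevinControlUVLatticeGapInUVUnitsGaugeReduction.lean`); `femtoSlabStub_of_stubs` recomposes S1.
* S2 `stub_slabToDecay : SlabToDecay` — THE ENGINE (LANDED p96985, lead -1's wave; M/L): `SlabInequality r β S D K`, `D, K ≥ 1` ⇒
  `CondExpDecay r β S D (1 − 1/K)`: Markov version of each iterate (tree) + law of total variance + induction on `j`;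
  the two load-bearing facts about the conventions are PROVED here (`slabExterior_step`: the margin-`D` exterior of
  the `jD`-enlarged slab is the margin-`(j+1)D` exterior; `slabExterior_anti`: exteriors are nested).
* S3 `stub_decayToClustering : DecayToClustering` — THE CURRENCY EXCHANGE (LANDED p97393, lead -1's wave; M/L): `CondExpDecay` at
  `(β, S, D, q)`, `q < 1` ⇒ `|latticeConnectedCorr r.ρ β (2S+1) A B n| ≤ C(A,B) e^{−κ(q) n/D}` for `n ≤ S`
  (covariance = covariance with the conditional expectation once `τ_n B` is exterior-measurable; Cauchy–Schwarz;
  support bookkeeping mod `2S+1`; small `n` by the a-priori bound `abs_latticeConnectedCorr_le`; PER-PAIR constants).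

Composition (`stubsImplyCrux`, sorry-free; `LatticeGapInUVUnits_of` concludes the crux BY NAME):
S0 hands a continuous dominating ruler `a'`; S1 at `a'`; S2; S3 with `q = 1 − 1/K`; `a' β ≤ Θ` eventually
(Disproof §4: `Tendsto a` is load-bearing exactly here) gives `⌈Θ/a' β⌉ · a' β ≤ 2Θ`, so `c₁ = κ/(2Θ)`,
`S₁` = S1's, `C = max C(A,B) 0` (`concl_of_slab`); `concl_of_dominated` returns to the units of `a`.

## Disproof used (`Cruxes/LatticeGapInUVUnits/Disproof.lean` gen 1 v5 + gen 2 v7; landed `Negative/*`)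

No `_false_without_<H>` theorem exists; its role is played by the LANDED negative lemma modulo H
`Negative.latticeGapInUVUnits_false_of_standardScalingSU : StandardScalingSU → ¬ LatticeGapInUVUnits` (any proof must
use a regularity of the unit map excluded by slow step rulers): HONOURED — S1 is stated for `Continuous a` (C′ of
Disproof §9, copied verbatim as `CruxRepaired` and PROVED from S1–S3, `cruxRepaired_of_stubs`), the typed residue is
isolated in S0, and `not_rulerReduction_of_not_crux` records that under H the socket, not the line, dies.
§0 `crux_iff` copied verbatim (composition definitional); §1 `conclRate_zero` / tree `abs_latticeConnectedCorr_le`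
(small-`n` regime of S3; `0 < c₁ = κ/(2Θ)` carries the content); §1+§2 = `concl_of_dominated`; §4 used in
`concl_of_slab`; §6 `packageWith_shape_tendsto_zero` consistent and unused (`Γ` never enters; the ruler enters only
through `⌈Θ/a β⌉`); §7 / landed `Negative.not_uniform_constant_clustering_of_simple`: respected — S3 and `Concl`
carry `∀ A B, ∃ C` (§5 `example`); §3 / landed `Negative.not_femto_lower_bound_of_subsingleton`: the junk group meets
no package (`not_package_of_subsingleton`), so no stub is instantiated there. No stub is an instance of a landed
Negative lemma. Barrier check in the statement of S1: Elitzur (`Literature.Barriers.QuantumFields.ElitzurTheorem`) —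
S1 quantifies over ALL bounded closed-slab observables; non-invariant components are annihilated by the exterior
conditioning (interior gauge transformations preserve the conditional law), so they only make the inequality
easier, and the gauge-invariant sub-class is the content; `FiniteTemperatureDeconfinement` — S1 speaks only of tori
`S ≥ S₁(β)` of S1's choosing (`S₁ ∝ Θ'/a(β)` puts the symmetric torus below any deconfinement temperature);
`AbelianDeconfinementD4` — S2/S3 are group-blind and TRUE, all `G`-dependence sits in S1's `K(Θ) < ∞`, which is
`∞` for lattice Maxwell (card (4): pinned photon modes keep the bridge fraction `tanh(ED)`), so the line proves no
clustering for `U(1)₄`.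
-/

open scoped BigOperators
open MeasureTheory Filter Topology
open Literature.MathematicalPhysics.QuantumFieldTheory Literature.MathematicalPhysics.QuantumLattice
open Summit.QuantumFields.YangMills.Theses.LangevinControlUV
open Summit.QuantumFields.YangMills.Theorems.LatticeGapInUVUnits.Negative
  (not_uniform_constant_clustering_of_simple)

noncomputable section

namespace Summit.QuantumFields.YangMills.Cruxes.LatticeGapInUVUnits.FemtoSlabNondegeneracy

/-! ## §0 Anatomy of the crux (verbatim `Cruxes/LatticeGapInUVUnits/Disproof.lean` §0) -/

section Anatomy

variable {G : Type} [Group G] [TopologicalSpace G] [IsTopologicalGroup G] [CompactSpace G]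
  [MeasurableSpace G] [BorelSpace G]

/-- The femto two-point bounds in ONE periodic box `(ℤ/L)⁴` at coupling `β` (verbatim the `let`-body of the crux's
hypothesis; = Disproof §0 `BoxBounds`). -/
def BoxBounds (r : LatticeRep G) (a Γ : ℝ → ℝ) (c C : ℝ) (L : ℕ) [NeZero L] (β : ℝ) : Prop :=
  let P : (Fin 4 → ZMod L) → Fin 4 → Fin 4 → GaugeConfig 4 L G → ℝ :=
    fun x i j U => (r.N : ℝ) - (r.ρ (plaquetteHolonomy U x i j)).trace.re
  let E : (GaugeConfig 4 L G → ℝ) → ℝ := fun F => wilsonExpectation (d := 4) (L := L) r.ρ β F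
  let cov : (GaugeConfig 4 L G → ℝ) → (GaugeConfig 4 L G → ℝ) → ℝ :=
    fun F F' => E (fun U => F U * F' U) - E F * E F'
  let dist : (Fin 4 → ZMod L) → (Fin 4 → ZMod L) → ℝ :=
    fun x y => Real.sqrt (∑ k : Fin 4, (((x k - y k).valMinAbs : ℤ) : ℝ) ^ 2)
  (∀ n : ℕ, 1 ≤ n → 8 * n ≤ L →
      c * Γ ((n : ℝ) * a β) ≤ (n : ℝ) ^ 8 * cov (P 0 0 1) (P (Pi.single (2 : Fin 4) ((n : ℕ) : ZMod L)) 0 1) ∧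
        (n : ℝ) ^ 8 * cov (P 0 0 1) (P (Pi.single (2 : Fin 4) ((n : ℕ) : ZMod L)) 0 1) ≤ C * Γ ((n : ℝ) * a β)) ∧
    (∀ (x y : Fin 4 → ZMod L) (i j i' j' : Fin 4), x ≠ y → i ≠ j → i' ≠ j' →
      |cov (P x i j) (P y i' j')| * dist x y ^ 8 ≤ C * Γ (dist x y * a β))

/-- The femto two-point PACKAGE of the unit map `a` (hypothesis of the crux; = Disproof §0 `Package`). -/
def Package (r : LatticeRep G) (a : ℝ → ℝ) : Prop :=
  ∃ (Γ : ℝ → ℝ) (β₀ ℓ₀ c C : ℝ), 0 < ℓ₀ ∧ 0 < c ∧ (∀ β, 0 < a β) ∧ Tendsto a atTop (𝓝 0) ∧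
    (∀ s : ℝ, 0 < s → s ≤ ℓ₀ → 0 < Γ s ∧ Γ s ≤ 1) ∧
      ∀ (L : ℕ) [NeZero L] (β : ℝ), β₀ ≤ β → (L : ℝ) * a β ≤ ℓ₀ → BoxBounds r a Γ c C L β

/-- The conclusion of the crux: volume-uniform exponential clustering of all pairs of gauge-invariant local
observables at SOME rate `c₁ · a(β)` per lattice step, PER-PAIR constants `C` (= Disproof §0 `Concl`). -/
def Concl (r : LatticeRep G) (a : ℝ → ℝ) : Prop :=
  ∃ (c₁ β₂ : ℝ) (S₁ : ℝ → ℕ), 0 < c₁ ∧ ∀ A B : YMSpecies G, ∃ C : ℝ, ∀ β : ℝ, β₂ ≤ β → ∀ S n : ℕ,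
    S₁ β ≤ S → n ≤ S → |latticeConnectedCorr r.ρ β (2 * S + 1) A.F B.F n| ≤ C * Real.exp (-(c₁ * a β * n))

end Anatomy

/-- **The crux uncurried** (definitional; = Disproof §0 `crux_iff`):
`LatticeGapInUVUnits ↔ ∀ G (compact simple) r a, Package r a → Concl r a`. -/
theorem crux_iff :
    LatticeGapInUVUnits ↔
      ∀ (G : Type) [Group G] [TopologicalSpace G] [IsTopologicalGroup G] [CompactSpace G],
        IsCompactSimpleLieGroup G →
          letI : MeasurableSpace G := borel G
          haveI : BorelSpace G := ⟨rfl⟩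
          ∀ (r : LatticeRep G) (a : ℝ → ℝ), Package r a → Concl r a := by
  constructor
  · intro h G _ _ _ _ hG r a hP
    obtain ⟨Γ, β₀, ℓ₀, c, C, hℓ, hc, hpos, hlim, hΓ, hbox⟩ := hP
    exact h G hG r a ⟨Γ, β₀, ℓ₀, c, C, hℓ, hc, hpos, hlim, hΓ, fun L _ β h₁ h₂ => hbox L β h₁ h₂⟩
  · intro h G _ _ _ _ hG r a hP
    obtain ⟨Γ, β₀, ℓ₀, c, C, hℓ, hc, hpos, hlim, hΓ, hbox⟩ := hP
    exact h G hG r a ⟨Γ, β₀, ℓ₀, c, C, hℓ, hc, hpos, hlim, hΓ, fun L _ β h₁ h₂ => hbox L β h₁ h₂⟩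

/-- **The repaired crux C′** (VERBATIM `Disproof.CruxRepaired`, the standing disprover's repair; classification
`refuted-misstated` if a kill ever lands): the crux restricted to CONTINUOUS unit maps. PROVED from S1–S3 alone
(`cruxRepaired_of_stubs`). -/
def CruxRepaired : Prop :=
  ∀ (G : Type) [Group G] [TopologicalSpace G] [IsTopologicalGroup G] [CompactSpace G],
    IsCompactSimpleLieGroup G →
      letI : MeasurableSpace G := borel G
      haveI : BorelSpace G := ⟨rfl⟩
      ∀ (r : LatticeRep G) (a : ℝ → ℝ), Continuous a → Package r a → Concl r a

/-- C′ is implied by the crux as filed (it only removes unit maps from the `∀`). -/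
theorem cruxRepaired_of_crux (h : LatticeGapInUVUnits) : CruxRepaired := by
  rw [crux_iff] at h
  intro G _ _ _ _ hG r a _ hP
  exact h G hG r a hP

/-! ## §1 Vocabulary: closed time-slabs of the torus, their exteriors at a margin, the slab inequality and the
decay of conditional expectations along nested exteriors -/

section Slabs

variable {G : Type} [MeasurableSpace G]

/-- **The closed time-slab** of base time `t₀` and width `w` on the torus `(ℤ/(2S+1))⁴` (Euclidean time = axis `0`,
the axis of `latticeConnectedCorr`'s translation `configShift (-Pi.single 0 n)`): the links whose BASE POINT has
time `t₀, t₀ + 1, …, t₀ + w − 1` (the spatial links at those times and the temporal links leaving them). A bounded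
observable reading only these links is a *closed-slab observable*; `w = 1` contains the time-zero (one-slice)
gauge-invariant observables of the card. For `w ≥ 2S+1` it is the whole torus. -/
def slabLinks (S : ℕ) (t₀ : ZMod (2 * S + 1)) (w : ℕ) : Set (Edge 4 (2 * S + 1)) :=
  {ℓ | (ℓ.1 0 - t₀).val < w}

variable (G) in
/-- **The exterior σ-algebra at margin `M` of the slab `(t₀, w)`**: generated (Mathlib `cylinderEvents`) by the link
variables based at time-offsets from `t₀` OUTSIDE `[−(M−1), w+M−1)`, i.e. at least `M` base-layers away from the
slab on either side of the periodic time (`M = 1`, and the junk value `M = 0`: all links off the slab). Conditioning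
on it freezes both far sides at time-distance `≥ M`. By the Markov property of the plaquette interaction (tree
`TorusWilsonMarkov`, `TorusWilsonGibbs`) the conditional expectation of a closed-slab observable given this
σ-algebra reads only the two FACE layers at offsets `−M` and `w+M−1`, hence is (a version of) a closed-slab
observable of the enlarged slab `(t₀ − M, w + 2M)` — and the exterior at margin `M'` of THAT slab is the exterior
at margin `M + M'` of the original one: the bookkeeping that makes `SlabToDecay` an induction. -/
@[reducible] def slabExterior (S : ℕ) (t₀ : ZMod (2 * S + 1)) (w M : ℕ) :
    MeasurableSpace (GaugeConfig 4 (2 * S + 1) G) :=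
  cylinderEvents (X := fun _ : Edge 4 (2 * S + 1) => G)
    (slabLinks S (t₀ - ((M - 1 : ℕ) : ZMod (2 * S + 1))) (w + 2 * (M - 1)))ᶜ

/-- **The conventions compose** (the identity behind the induction step of `SlabToDecay`): the margin-`D` exterior of
the `jD`-enlarged slab `(t₀ − jD, w + 2jD)` IS the margin-`(j+1)D` exterior of the slab `(t₀, w)` (`D ≥ 1`). -/
theorem slabExterior_step (S : ℕ) (t₀ : ZMod (2 * S + 1)) (w j D : ℕ) (hD : 1 ≤ D) :
    slabExterior G S (t₀ - ((j * D : ℕ) : ZMod (2 * S + 1))) (w + 2 * (j * D)) D =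
      slabExterior G S t₀ w ((j + 1) * D) := by
  have h1 : (j + 1) * D - 1 = j * D + (D - 1) := by
    have : (j + 1) * D = j * D + D := by ring
    omega
  have h2 : t₀ - ((j * D : ℕ) : ZMod (2 * S + 1)) - ((D - 1 : ℕ) : ZMod (2 * S + 1)) =
      t₀ - (((j + 1) * D - 1 : ℕ) : ZMod (2 * S + 1)) := by
    rw [h1]; push_cast; ring
  have h3 : w + 2 * (j * D) + 2 * (D - 1) = w + 2 * ((j + 1) * D - 1) := by
    rw [h1]; ring
  simp only [slabExterior, h2, h3]

omit [MeasurableSpace G] in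
/-- Enlarging a slab by `R` layers on both sides is monotone in `R` (unconditionally: `ZMod.val` is subadditive). -/
theorem slabLinks_enlarge_mono (S : ℕ) (t₀ : ZMod (2 * S + 1)) (w : ℕ) {R R' : ℕ} (h : R ≤ R') :
    slabLinks S (t₀ - (R : ZMod (2 * S + 1))) (w + 2 * R) ⊆
      slabLinks S (t₀ - (R' : ZMod (2 * S + 1))) (w + 2 * R') := by
  intro ℓ hℓ
  simp only [slabLinks, Set.mem_setOf_eq] at hℓ ⊢
  have e : ℓ.1 0 - (t₀ - (R' : ZMod (2 * S + 1))) =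
      (ℓ.1 0 - (t₀ - (R : ZMod (2 * S + 1)))) + ((R' - R : ℕ) : ZMod (2 * S + 1)) := by
    rw [Nat.cast_sub h]; ring
  rw [e]
  calc ((ℓ.1 0 - (t₀ - (R : ZMod (2 * S + 1)))) + ((R' - R : ℕ) : ZMod (2 * S + 1))).val
      ≤ (ℓ.1 0 - (t₀ - (R : ZMod (2 * S + 1)))).val + (((R' - R : ℕ) : ZMod (2 * S + 1))).val :=
        ZMod.val_add_le _ _
    _ ≤ (ℓ.1 0 - (t₀ - (R : ZMod (2 * S + 1)))).val + (R' - R) := by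
        gcongr
        rw [ZMod.val_natCast]
        exact Nat.mod_le _ _
    _ < w + 2 * R + (R' - R) := by omega
    _ ≤ w + 2 * R' := by omega

/-- **The exteriors are nested** (the tower property applies along them): a larger margin means a coarser exterior
σ-algebra, `slabExterior S t₀ w M' ≤ slabExterior S t₀ w M` for `M ≤ M'`. -/
theorem slabExterior_anti (S : ℕ) (t₀ : ZMod (2 * S + 1)) (w : ℕ) {M M' : ℕ} (h : M ≤ M') :
    slabExterior G S t₀ w M' ≤ slabExterior G S t₀ w M :=
  cylinderEvents_mono (Set.compl_subset_compl.2 (slabLinks_enlarge_mono S t₀ w (Nat.sub_le_sub_right h 1)))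

omit [MeasurableSpace G] in
/-- Slabs are monotone in the width. -/
theorem slabLinks_mono (S : ℕ) (t₀ : ZMod (2 * S + 1)) {w w' : ℕ} (h : w ≤ w') :
    slabLinks S t₀ w ⊆ slabLinks S t₀ w' := fun _ hℓ => lt_of_lt_of_le hℓ h

omit [MeasurableSpace G] in
/-- A slab of width `≥ 2S+1` is the whole torus (the width constraints below exclude exactly this wrap-around). -/
theorem slabLinks_eq_univ (S : ℕ) (t₀ : ZMod (2 * S + 1)) {w : ℕ} (h : 2 * S + 1 ≤ w) :
    slabLinks S t₀ w = Set.univ :=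
  Set.eq_univ_of_forall fun _ => lt_of_lt_of_le (ZMod.val_lt _) h

end Slabs

section Inequalities

variable {G : Type} [Group G] [TopologicalSpace G] [IsTopologicalGroup G] [CompactSpace G]
  [MeasurableSpace G] [BorelSpace G]

/-- **SLAB NON-DEGENERACY at margin `D` with constant `K`** for Wilson's measure `μ = wilsonMeasure r.ρ β` on the
torus `(2S+1)⁴` (the card's lever `Var f ≤ K · E Var(f∘τ_D | slices 0, 2D)` in its TWO-face form — the only form a
periodic time admits — stated DELIBERATELY for every closed time-slab, as the panel asked; a Dobrushin–Shlosman-type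
slab-decoupling CERTIFICATE in `L²`, non-degeneracy not smallness): for every slab `(t₀, w)` whose `D`-enlargement
fits (`w + 2D ≤ 2S`) and every bounded measurable `F` reading only the links of the slab,
`∫ (F − ∫F)² dμ ≤ K · ∫ (F − μ[F | exterior at margin D])² dμ` — freezing everything at time-distance `≥ D` from the
support retains at least the fraction `1/K` of the variance. Equivalently (law of total variance)
`Var(μ[F | ext_D]) ≤ (1 − 1/K) Var F`: the `L²(μ)`-maximal correlation (ρ-mixing coefficient) between the slab and
its margin-`D` exterior is `≤ √(1 − 1/K)`. Amplitude-blind (a sup over all `F`), `β`-slack-free, group-blind as a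
SHAPE; all physics is in which `(D, K)` are admissible. `F` is NOT required to be gauge-invariant: for `D ≥ 2` the
gauge transformations at the sites of the slab fix every exterior link, preserve `μ` and hence the conditional
expectation given the exterior, so `μ[F | ext_D] = μ[F̄ | ext_D]` for the gauge-average `F̄` of `F` (again a slab
observable, fully gauge-invariant, `Var F̄ ≤ Var F`): non-invariant components only make the inequality easier
(Elitzur), and the gauge-invariant closed-slab observables are the content. (At `D = 1` a single link adjacent to
the frozen layer is pinned by its staple and would violate the inequality at large `β` — the user of this predicate,
`FemtoSlabStub`, takes `D(β) = ⌈Θ/a(β)⌉ → ∞`.) -/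
def SlabInequality (r : LatticeRep G) (β : ℝ) (S D : ℕ) (K : ℝ) : Prop :=
  ∀ (t₀ : ZMod (2 * S + 1)) (w : ℕ), w + 2 * D ≤ 2 * S →
    ∀ F : GaugeConfig 4 (2 * S + 1) G → ℝ, Measurable F → (∃ M : ℝ, ∀ U, |F U| ≤ M) →
      DependsOn F (slabLinks S t₀ w) →
        ∫ U, (F U - ∫ V, F V ∂(wilsonMeasure (d := 4) (L := 2 * S + 1) r.ρ β)) ^ 2
            ∂(wilsonMeasure (d := 4) (L := 2 * S + 1) r.ρ β) ≤
          K * ∫ U, (F U - ((wilsonMeasure (d := 4) (L := 2 * S + 1) r.ρ β)[F|slabExterior G S t₀ w D]) U) ^ 2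
            ∂(wilsonMeasure (d := 4) (L := 2 * S + 1) r.ρ β)

/-- **SLAB NON-DEGENERACY FOR GAUGE-INVARIANT OBSERVABLES** — `SlabInequality` with the test observables `F`
restricted to the (everywhere) gauge-invariant ones (`IsGaugeInvariant F`): the physically meaningful content of the
slab inequality (Elitzur). For margins `D ≥ 2` it implies the unrestricted `SlabInequality` with the SAME constant
(`GaugeReduction`, stub S1r, provable now: orbit averaging over the gauge group; the non-invariant part of `F` is
orthogonal to every function invariant under the gauge transformations at the sites touching the slab, in particular
to `L²` of the margin-`D` exterior, whose links those transformations fix when `D ≥ 2`). -/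
def SlabInequalityGI (r : LatticeRep G) (β : ℝ) (S D : ℕ) (K : ℝ) : Prop :=
  ∀ (t₀ : ZMod (2 * S + 1)) (w : ℕ), w + 2 * D ≤ 2 * S →
    ∀ F : GaugeConfig 4 (2 * S + 1) G → ℝ, Measurable F → (∃ M : ℝ, ∀ U, |F U| ≤ M) →
      IsGaugeInvariant F → DependsOn F (slabLinks S t₀ w) →
        ∫ U, (F U - ∫ V, F V ∂(wilsonMeasure (d := 4) (L := 2 * S + 1) r.ρ β)) ^ 2
            ∂(wilsonMeasure (d := 4) (L := 2 * S + 1) r.ρ β) ≤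
          K * ∫ U, (F U - ((wilsonMeasure (d := 4) (L := 2 * S + 1) r.ρ β)[F|slabExterior G S t₀ w D]) U) ^ 2
            ∂(wilsonMeasure (d := 4) (L := 2 * S + 1) r.ρ β)

/-- The unrestricted slab inequality trivially implies the gauge-invariant one. -/
theorem slabInequalityGI_of_slabInequality {r : LatticeRep G} {β : ℝ} {S D : ℕ} {K : ℝ}
    (h : SlabInequality r β S D K) : SlabInequalityGI r β S D K :=
  fun t₀ w hw F hFm hFb _ hFd => h t₀ w hw F hFm hFb hFd

/-- **GEOMETRIC DECAY OF CONDITIONAL EXPECTATIONS along the nested exteriors of one slab**, margin unit `D`,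
ratio `q`: for every slab `(t₀, w)`, every `j` with `w + 2jD ≤ 2S` and every bounded measurable `F` reading only the
slab, `Var(μ[F | exterior at margin jD]) ≤ q^j · Var F` (at `j = 0` this is the contraction of conditional
expectation). For a stationary reversible Markov chain this is the submultiplicativity of the ρ-mixing coefficient,
`ρ(jD) ≤ ρ(D)^j` — the measure-theoretic twin of `‖T^{jD}|_{Ω^⊥}‖ ≤ ‖T^D|_{Ω^⊥}‖^j`; here it is the OUTPUT of
`SlabToDecay` and the INPUT of `DecayToClustering`. -/
def CondExpDecay (r : LatticeRep G) (β : ℝ) (S D : ℕ) (q : ℝ) : Prop :=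
  ∀ (t₀ : ZMod (2 * S + 1)) (w j : ℕ), w + 2 * (j * D) ≤ 2 * S →
    ∀ F : GaugeConfig 4 (2 * S + 1) G → ℝ, Measurable F → (∃ M : ℝ, ∀ U, |F U| ≤ M) →
      DependsOn F (slabLinks S t₀ w) →
        ∫ U, (((wilsonMeasure (d := 4) (L := 2 * S + 1) r.ρ β)[F|slabExterior G S t₀ w (j * D)]) U -
              ∫ V, F V ∂(wilsonMeasure (d := 4) (L := 2 * S + 1) r.ρ β)) ^ 2
            ∂(wilsonMeasure (d := 4) (L := 2 * S + 1) r.ρ β) ≤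
          q ^ j * ∫ U, (F U - ∫ V, F V ∂(wilsonMeasure (d := 4) (L := 2 * S + 1) r.ρ β)) ^ 2
            ∂(wilsonMeasure (d := 4) (L := 2 * S + 1) r.ρ β)

end Inequalities

/-! ## §2 The four stub statements -/

/-- **Stub S0 statement — ruler reduction (the typed-`∀a` socket; VERBATIM the sibling lines'
`KnabeBlockSampler.RulerReduction` / `OneRuler.RulerReduction`).** Every unit map carrying the femto package is
eventually dominated, up to a constant `K₀`, by a CONTINUOUS unit map carrying the package. The identity on
continuous rulers (`rulerReduction_of_continuous`); for the slow STEP rulers of the Disproof's PAPER KILL it is false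
exactly as the crux is — under `StandardScalingSU` provably so (`not_rulerReduction_of_not_crux` with the landed
`Negative.latticeGapInUVUnits_false_of_standardScalingSU`). This is where the typed crux's misstatement is parked;
NOT a work item: it becomes moot when 9366 is restated as C′. -/
def RulerReduction : Prop :=
  ∀ (G : Type) [Group G] [TopologicalSpace G] [IsTopologicalGroup G] [CompactSpace G],
    IsCompactSimpleLieGroup G →
      letI : MeasurableSpace G := borel G
      haveI : BorelSpace G := ⟨rfl⟩
      ∀ (r : LatticeRep G) (a : ℝ → ℝ), Package r a →
        ∃ (a' : ℝ → ℝ) (K₀ : ℝ), Continuous a' ∧ Package r a' ∧ 0 < K₀ ∧ ∀ᶠ β in atTop, a β ≤ K₀ * a' β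

/-- **Stub S1 statement — FEMTO-SLAB NON-DEGENERACY (THE PHYSICS; hardest, open).** For every compact simple `G`,
faithful `r` and CONTINUOUS unit map `a` carrying the femto package there are a physical thickness `Θ > 0`, a
constant `K ≥ 1`, a coupling `β₂` and torus sizes `S₁ : ℝ → ℕ` such that for all `β ≥ β₂` and all `S ≥ S₁ β` the slab
inequality holds on `(2S+1)⁴` at margin `D(β) := ⌈Θ / a β⌉` with constant `K` — uniformly in `β` (CONSTANT SLACK:
femto units lose nothing), in the volume and in the slab (`β₂` is the prover's: beyond it `a(β) < Θ`, so `D(β) ≥ 2`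
and `D(β) → ∞`). Physically `K(Θ) ≈ max(1, ξ/(Θ L₀))`: finite iff the
theory is gapped at the scale of the femto ruler (lattice Maxwell: `K = ∞` at every `Θ`, the pinned photon mode of
energy `E` keeps only the Brownian-bridge fraction `tanh(ED)` of its variance); continuity of `a` pins the ruler to
the physical spacing (one-ruler's `rulerRigidity_continuous`, Disproof §11), so `Θ/a(β)` IS a fixed physical length;
`S₁ ∝ Θ'/a(β)` keeps torelons heavy and the symmetric torus cold. This is the honest residue: the mass gap at one
physical scale, in conditional-variance clothing — different in SHAPE from the crux (one inequality at one thickness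
per `β`; sup over observables instead of all pairs / all distances; possibly strictly stronger, as two-sided
conditioning is not implied by the norm gap alone). -/
def FemtoSlabStub : Prop :=
  ∀ (G : Type) [Group G] [TopologicalSpace G] [IsTopologicalGroup G] [CompactSpace G],
    IsCompactSimpleLieGroup G →
      letI : MeasurableSpace G := borel G
      haveI : BorelSpace G := ⟨rfl⟩
      ∀ (r : LatticeRep G) (a : ℝ → ℝ), Continuous a → Package r a →
        ∃ (Θ K β₂ : ℝ) (S₁ : ℝ → ℕ), 0 < Θ ∧ 1 ≤ K ∧
          ∀ β : ℝ, β₂ ≤ β → ∀ S : ℕ, S₁ β ≤ S → SlabInequality r β S ⌈Θ / a β⌉₊ K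

/-- **Stub S1' statement — FEMTO-SLAB NON-DEGENERACY FOR GAUGE-INVARIANT OBSERVABLES (THE PHYSICS, reshaped by
Elitzur; hardest, open).** `FemtoSlabStub` with the slab inequality asked only of gauge-invariant closed-slab
observables (`SlabInequalityGI`). Together with the gauge reduction S1r (`GaugeReduction`, provable now) it gives
`FemtoSlabStub` beyond the coupling where `a β < Θ` (then `⌈Θ/a β⌉ ≥ 2`): `femtoSlabStub_of_GI`. This is the form in
which the residue should be read: ONE two-sided conditional-variance inequality per coupling for the GAUGE-INVARIANT
functions of a closed time-slab of the cold symmetric torus, at the femto thickness `⌈Θ/a β⌉`, constant `K` uniform in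
`β`, volume and slab — the mass gap at one physical scale. -/
def FemtoSlabStubGI : Prop :=
  ∀ (G : Type) [Group G] [TopologicalSpace G] [IsTopologicalGroup G] [CompactSpace G],
    IsCompactSimpleLieGroup G →
      letI : MeasurableSpace G := borel G
      haveI : BorelSpace G := ⟨rfl⟩
      ∀ (r : LatticeRep G) (a : ℝ → ℝ), Continuous a → Package r a →
        ∃ (Θ K β₂ : ℝ) (S₁ : ℝ → ℕ), 0 < Θ ∧ 1 ≤ K ∧
          ∀ β : ℝ, β₂ ≤ β → ∀ S : ℕ, S₁ β ≤ S → SlabInequalityGI r β S ⌈Θ / a β⌉₊ K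

/-- **Stub S1r statement — GAUGE REDUCTION OF THE SLAB INEQUALITY (Elitzur; provable now, M).** For every compact `G`,
unitary `r`, coupling `β`, torus `S`, margin `D ≥ 2` and `K ≥ 1`: `SlabInequalityGI r β S D K → SlabInequality r β S D K`.
Proof route: average `F` over the product Haar measure of the gauge group, `F̄ U = ∫ F(U^g) dπ(g)` (tree
`FradkinShenkerFlowSusceptibilityToPoincareOrbitSliceSplit`: measurable, same bound, gauge-invariant; slab-supported
since `F` is); gauge invariance of `μ` (`integral_comp_gaugeTransform_wilsonMeasure`) and Fubini give
`∫ F̄ H dμ = ∫ F H dμ` for every bounded measurable `H` invariant under the gauge transformations supported on the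
sites touching the slab — these fix every link of the margin-`D` exterior when `D ≥ 2`, so every exterior-measurable
`H` qualifies, as does `H = F̄ − c`. Hence `μ[F̄ | ext_D] = μ[F | ext_D]`, `Var F = Var F̄ + ‖F − F̄‖²`,
`∫(F − μ[F|ext_D])² = ∫(F̄ − μ[F̄|ext_D])² + ‖F − F̄‖²`, and the gauge-invariant inequality for `F̄` with `K ≥ 1`
gives the inequality for `F`. -/
def GaugeReduction : Prop :=
  ∀ (G : Type) [Group G] [TopologicalSpace G] [IsTopologicalGroup G] [CompactSpace G]
    [MeasurableSpace G] [BorelSpace G] (r : LatticeRep G) (β : ℝ) (S D : ℕ) (K : ℝ),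
    2 ≤ D → 1 ≤ K → SlabInequalityGI r β S D K → SlabInequality r β S D K

/-- **Stub S2 statement — SLAB INEQUALITY ⇒ DECAY OF CONDITIONAL EXPECTATIONS (THE ENGINE; provable now, M/L).**
For every compact `G`, unitary `r`, coupling `β`, torus `S`, margin `D ≥ 1` and `K ≥ 1`: `SlabInequality r β S D K`
implies `CondExpDecay r β S D (1 − 1/K)`. Proof route (all ingredients in the tree): induction on `j` with two base
cases. `j = 0`: the contraction `∫ (μ[F|𝓕] − ∫F)² ≤ ∫ (F − ∫F)²` (`TorusWilsonMarkov.integral_condExp_sq_le_of_ae_bdd`).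
`j = 1`: the slab inequality for `F` itself and the law of total variance `Var(μ[F|𝓕]) = Var F − ∫ (F − μ[F|𝓕])²`
(orthogonality of `condExp`) give `Var(μ[F | ext_D]) ≤ (1 − 1/K) Var F`. Step `j → j+1` (`j ≥ 1`): the Markov
property of the torus Wilson state (`isGibbsMeasure_wilsonMeasure`,
`stronglyMeasurable_and_ae_eq_condExp_integral_gibbsSpecOfPotential`, the pattern of `condExp_wilsonMeasure_markov_slab`
with `le_and_le_mod_of_plaquette`: a plaquette meeting the conditioning interior `[−(jD−1), w+jD−1)` reads outside it
only the two FACE layers at offsets `−jD` and `w+jD−1`) gives a bounded measurable version `G_j` of `μ[F | ext_{jD}]`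
with `DependsOn G_j (slabLinks S (t₀ − jD) (w + 2jD))`; the slab inequality applied to `G_j` — its margin-`D`
exterior IS the `(j+1)D`-exterior of the original slab (`slabExterior_step`, PROVED: `slabExterior S (t₀ − jD)
(w + 2jD) D = slabExterior S t₀ w ((j+1)D)`) — the tower property `μ[G_j | ext_{(j+1)D}] = μ[F | ext_{(j+1)D}]` a.e.
(the exteriors are nested, `slabExterior_anti`, PROVED) and the law of total variance give
`Var(μ[F | ext_{(j+1)D}]) ≤ (1 − 1/K) Var G_j ≤ (1 − 1/K)^{j+1} Var F`. Group-blind, `β`-blind, TRUE. -/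
def SlabToDecay : Prop :=
  ∀ (G : Type) [Group G] [TopologicalSpace G] [IsTopologicalGroup G] [CompactSpace G]
    [MeasurableSpace G] [BorelSpace G] (r : LatticeRep G) (β : ℝ) (S D : ℕ) (K : ℝ),
    1 ≤ D → 1 ≤ K → SlabInequality r β S D K → CondExpDecay r β S D (1 - 1 / K)

/-- **Stub S3 statement — DECAY ⇒ CLUSTERING IN THE CRUX'S CURRENCY (provable now, M/L).** For every compact `G`,
unitary `r` and ratio `0 ≤ q < 1` there is a rate `κ = κ(q) > 0` (e.g. `−(log q)/2`, or `1` when `q = 0`) such that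
every pair of gauge-invariant local observables `A, B` has a constant `C = C(A, B, q)` (NOT uniform in the pair —
Disproof §7) with: whenever `CondExpDecay r β S D q` holds (`D ≥ 1`), `|latticeConnectedCorr r.ρ β (2S+1) A B n| ≤
C e^{−κ n/D}` for all `n ≤ S`. Proof route: on the torus, `A ∘ torusLift` reads a closed slab `(t_A, w_A)` and
`τ_n B ∘ torusLift` reads links at times `n + [t_B, t_B + w_B)`; for `j := ⌊(n − c_{AB})/D⌋` (`c_{AB}` a support
constant) the latter is `slabExterior S t_A w_A (jD)`-measurable and `w_A + 2jD ≤ 2S`, so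
`Cov(A, τ_nB) = Cov(μ[A | ext_{jD}], τ_nB) ≤ (q^j Var A)^{1/2} (Var B)^{1/2} ≤ 4 C_A C_B q^{j/2}`; `n < c_{AB} + D` is
absorbed by the a-priori bound `|corr| ≤ 2 C_A C_B` (`abs_latticeConnectedCorr_le`). Constants combinatorial in the
supports and sup norms: uniform in `β, S, D, n`. -/
def DecayToClustering : Prop :=
  ∀ (G : Type) [Group G] [TopologicalSpace G] [IsTopologicalGroup G] [CompactSpace G]
    [MeasurableSpace G] [BorelSpace G] (r : LatticeRep G) (q : ℝ), 0 ≤ q → q < 1 →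
      ∃ κ : ℝ, 0 < κ ∧ ∀ A B : YMSpecies G, ∃ C : ℝ, ∀ (β : ℝ) (S D n : ℕ), 1 ≤ D → n ≤ S →
        CondExpDecay r β S D q →
          |latticeConnectedCorr r.ρ β (2 * S + 1) A.F B.F n| ≤ C * Real.exp (-(κ / D * n))

/-! ## §3 Registered stubs and the checked composition -/

/-- Stub S0 (typed-`∀a` socket; NOT a work item — see `RulerReduction` and `not_rulerReduction_of_not_crux`). -/
theorem stub_rulerReduction : RulerReduction := by
  sorry

/-- Stub S1' (open, HARDEST: slab non-degeneracy for GAUGE-INVARIANT closed-slab observables at the femto thickness,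
`β`- and volume-uniform `K`; the physics residue after the Elitzur reshape). -/
theorem stub_femtoSlabGI : FemtoSlabStubGI := by
  sorry

/-- Stub S1r — LANDED (p104023, `Theorems/LangevinControlUVLatticeGapInUVUnitsGaugeReduction.lean`, this seat; Elitzur by
orbit averaging). Registered with its EXPLICIT, definition-free signature
(= `GaugeReduction` with `SlabInequalityGI`, `SlabInequality`, `slabLinks`, `slabExterior` unfolded and the torus Wilson
state abstracted as `μ`; `gaugeReduction_of_stub` is the definitional identification) so that the helper file
`Theorems/LangevinControlUVLatticeGapInUVUnitsGaugeReduction.lean` can state it without this file. -/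
theorem stub_gaugeReduction : ∀ (G : Type) [Group G] [TopologicalSpace G] [IsTopologicalGroup G] [CompactSpace G] [MeasurableSpace G] [BorelSpace G] (r : LatticeRep G) (β : ℝ) (S D : ℕ) (K : ℝ) (μ : Measure (GaugeConfig 4 (2 * S + 1) G)), μ = (wilsonMeasure r.ρ β : Measure (GaugeConfig 4 (2 * S + 1) G)) → 2 ≤ D → 1 ≤ K → (∀ (t₀ : ZMod (2 * S + 1)) (w : ℕ), w + 2 * D ≤ 2 * S → ∀ F : GaugeConfig 4 (2 * S + 1) G → ℝ, Measurable F → (∃ M : ℝ, ∀ U, |F U| ≤ M) → IsGaugeInvariant F → DependsOn F {ℓ : Edge 4 (2 * S + 1) | (ℓ.1 0 - t₀).val < w} → ∫ U, (F U - ∫ V, F V ∂μ) ^ 2 ∂μ ≤ K * ∫ U, (F U - (μ[F|cylinderEvents {ℓ : Edge 4 (2 * S + 1) | (ℓ.1 0 - (t₀ - ((D - 1 : ℕ) : ZMod (2 * S + 1)))).val < w + 2 * (D - 1)}ᶜ]) U) ^ 2 ∂μ) → ∀ (t₀ : ZMod (2 * S + 1)) (w : ℕ), w + 2 * D ≤ 2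 * S → ∀ F : GaugeConfig 4 (2 * S + 1) G → ℝ, Measurable F → (∃ M : ℝ, ∀ U, |F U| ≤ M) → DependsOn F {ℓ : Edge 4 (2 * S + 1) | (ℓ.1 0 - t₀).val < w} → ∫ U, (F U - ∫ V, F V ∂μ) ^ 2 ∂μ ≤ K * ∫ U, (F U - (μ[F|cylinderEvents {ℓ : Edge 4 (2 * S + 1) | (ℓ.1 0 - (t₀ - ((D - 1 : ℕ) : ZMod (2 * S + 1)))).val < w + 2 * (D - 1)}ᶜ]) U) ^ 2 ∂μ :=
  Summit.QuantumFields.YangMills.Theorems.LatticeGapInUVUnits.FemtoSlabNondegeneracy.stub_gaugeReduction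

/-- The explicit stub S1r IS `GaugeReduction` (definitional unfolding). -/
theorem gaugeReduction_of_stub : GaugeReduction := fun G _ _ _ _ _ _ r β S D K hD hK hgi =>
  stub_gaugeReduction G r β S D K _ rfl hD hK hgi

/-- **S1' + S1r ⇒ S1**: beyond the coupling where `a β < Θ` the femto margin `⌈Θ/a β⌉` is `≥ 2` (this is the second place
where `Tendsto a atTop (𝓝 0)` of the package is used), so the gauge reduction applies. -/
theorem femtoSlabStub_of_GI (h1 : FemtoSlabStubGI) (hr : GaugeReduction) : FemtoSlabStub := by
  intro G _ _ _ _ hG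
  letI : MeasurableSpace G := borel G
  haveI : BorelSpace G := ⟨rfl⟩
  intro r a ha hP
  obtain ⟨Θ, K, β₂, S₁, hΘ, hK, hslab⟩ := h1 G hG r a ha hP
  obtain ⟨Γ, β₀, ℓ₀, c, C, -, -, hpos, hlim, -, -⟩ := hP
  obtain ⟨β₃, hβ₃⟩ := eventually_atTop.1 (hlim (Iio_mem_nhds hΘ))
  refine ⟨Θ, K, max β₂ β₃, S₁, hΘ, hK, fun β hβ S hS => ?_⟩
  have haΘ : a β < Θ := hβ₃ β ((le_max_right _ _).trans hβ)
  have h1lt : (1 : ℝ) < Θ / a β := by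
    rw [lt_div_iff₀ (hpos β)]; linarith
  have hD2 : 2 ≤ ⌈Θ / a β⌉₊ := Nat.lt_ceil.2 (by exact_mod_cast h1lt)
  exact hr G r β S _ K hD2 hK (hslab β ((le_max_left _ _).trans hβ) S hS)

/-- S1 (all bounded closed-slab observables) from the two registered stubs S1' and S1r. -/
theorem femtoSlabStub_of_stubs : FemtoSlabStub := femtoSlabStub_of_GI stub_femtoSlabGI gaugeReduction_of_stub

/-- Stub S2 — LANDED (p96985, `Theorems/LangevinControlUVLatticeGapInUVUnitsSlabToDecay.lean`, lead -1's wave; Markov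
versions + law of total variance + induction along nested exteriors).
Registered with its EXPLICIT, definition-free signature (= `SlabToDecay` with `SlabInequality`, `CondExpDecay`,
`slabLinks`, `slabExterior` unfolded, the torus Wilson state abstracted as `μ` with `μ = wilsonMeasure r.ρ β`, so that the
registered text contains no `:=`; `slabToDecay_of_stub` is the definitional identification) so that the landed
helper file `Theorems/LangevinControlUVLatticeGapInUVUnitsSlabToDecay.lean` can state it without this file. -/
theorem stub_slabToDecay : ∀ (G : Type) [Group G] [TopologicalSpace G] [IsTopologicalGroup G] [CompactSpace G] [MeasurableSpace G] [BorelSpace G] (r : LatticeRep G) (β : ℝ) (S D : ℕ) (K : ℝ) (μ : Measure (GaugeConfig 4 (2 * S + 1) G)), μ = (wilsonMeasure r.ρ β : Measure (GaugeConfig 4 (2 * S + 1) G)) → 1 ≤ D → 1 ≤ K → (∀ (t₀ : ZMod (2 * S + 1)) (w : ℕ), w + 2 * D ≤ 2 * S → ∀ F : GaugeConfig 4 (2 * S + 1) G → ℝ, Measurable F → (∃ M : ℝ, ∀ U, |F U| ≤ M) → DependsOn F {ℓ : Edge 4 (2 * S + 1) | (ℓ.1 0 - t₀).val < w} → ∫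 U, (F U - ∫ V, F V ∂μ) ^ 2 ∂μ ≤ K * ∫ U, (F U - (μ[F|cylinderEvents {ℓ : Edge 4 (2 * S + 1) | (ℓ.1 0 - (t₀ - ((D - 1 : ℕ) : ZMod (2 * S + 1)))).val < w + 2 * (D - 1)}ᶜ]) U) ^ 2 ∂μ) → ∀ (t₀ : ZMod (2 * S + 1)) (w j : ℕ), w + 2 * (j * D) ≤ 2 * S → ∀ F : GaugeConfig 4 (2 * S + 1) G → ℝ, Measurable F → (∃ M : ℝ, ∀ U, |F U| ≤ M) → DependsOn F {ℓ : Edge 4 (2 * S + 1) | (ℓ.1 0 - t₀).val < w} → ∫ U, ((μ[F|cylinderEvents {ℓ : Edge 4 (2 * S + 1) | (ℓ.1 0 - (t₀ - ((j * D - 1 : ℕ) : ZMod (2 * S + 1)))).val < w + 2 * (j * D - 1)}ᶜ]) U - ∫ V, F V ∂μ) ^ 2 ∂μ ≤ (1 - 1 / K) ^ j * ∫ U, (F U - ∫ V, F V ∂μ) ^ 2 ∂μ :=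
  Summit.QuantumFields.YangMills.Theorems.LatticeGapInUVUnits.FemtoSlabNondegeneracy.stub_slabToDecay

/-- The explicit stub S2 IS `SlabToDecay` (definitional unfolding). -/
theorem slabToDecay_of_stub : SlabToDecay := fun G _ _ _ _ _ _ r β S D K hD hK hslab =>
  stub_slabToDecay G r β S D K _ rfl hD hK hslab

/-- Stub S3 — LANDED (p97393, `Theorems/LangevinControlUVLatticeGapInUVUnitsDecayToClustering.lean`, lead -1's wave;
covariance with the conditional expectation, AM–GM, support bookkeeping mod `2S+1`).
Registered with its EXPLICIT, definition-free signature (= `DecayToClustering` with `CondExpDecay`, `slabLinks`,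
`slabExterior` unfolded, the torus Wilson state abstracted as `μ` with `μ = wilsonMeasure r.ρ β`, so that the registered
text contains no `:=`; `decayToClustering_of_stub` is the definitional identification) so that the landed helper
file `Theorems/LangevinControlUVLatticeGapInUVUnitsDecayToClustering.lean` can state it without this file. -/
theorem stub_decayToClustering : ∀ (G : Type) [Group G] [TopologicalSpace G] [IsTopologicalGroup G] [CompactSpace G] [MeasurableSpace G] [BorelSpace G] (r : LatticeRep G) (q : ℝ), 0 ≤ q → q < 1 → ∃ κ : ℝ, 0 < κ ∧ ∀ A B : YMSpecies G, ∃ C : ℝ, ∀ (β : ℝ) (S D n : ℕ) (μ : Measure (GaugeConfig 4 (2 * S + 1) G)), μ = (wilsonMeasure r.ρ β : Measure (GaugeConfig 4 (2 * S + 1) G)) → 1 ≤ D → n ≤ S → (∀ (t₀ : ZMod (2 * S + 1)) (w j : ℕ), w + 2 * (j * D) ≤ 2 * S → ∀ F : GaugeConfig 4 (2 * S + 1) G → ℝ, Measurable F → (∃ M : ℝ, ∀ U, |F U| ≤ M) → DependsOn F {ℓ : Edge 4 (2 * S + 1) | (ℓ.1 0 - t₀).val < w} → ∫ U, ((μ[F|cylinderEvents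 {ℓ : Edge 4 (2 * S + 1) | (ℓ.1 0 - (t₀ - ((j * D - 1 : ℕ) : ZMod (2 * S + 1)))).val < w + 2 * (j * D - 1)}ᶜ]) U - ∫ V, F V ∂μ) ^ 2 ∂μ ≤ q ^ j * ∫ U, (F U - ∫ V, F V ∂μ) ^ 2 ∂μ) → |latticeConnectedCorr r.ρ β (2 * S + 1) A.F B.F n| ≤ C * Real.exp (-(κ / D * n)) :=
  Summit.QuantumFields.YangMills.Theorems.LatticeGapInUVUnits.FemtoSlabNondegeneracy.stub_decayToClustering

/-- The explicit stub S3 IS `DecayToClustering` (definitional unfolding). -/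
theorem decayToClustering_of_stub : DecayToClustering := fun G _ _ _ _ _ _ r q hq0 hq1 => by
  obtain ⟨κ, hκ, h⟩ := stub_decayToClustering G r q hq0 hq1
  refine ⟨κ, hκ, fun A B => ?_⟩
  obtain ⟨C, hC⟩ := h A B
  exact ⟨C, fun β S D n hD hn hdec => hC β S D n _ rfl hD hn hdec⟩

section Composition

variable {G : Type} [Group G] [TopologicalSpace G] [IsTopologicalGroup G] [CompactSpace G]
  [MeasurableSpace G] [BorelSpace G]

/-- S0 is the identity on continuous rulers (so under the repair C′ it carries no content). -/
theorem rulerReduction_of_continuous (r : LatticeRep G) {a : ℝ → ℝ} (ha : Continuous a)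
    (hP : Package r a) :
    ∃ (a' : ℝ → ℝ) (K₀ : ℝ), Continuous a' ∧ Package r a' ∧ 0 < K₀ ∧ ∀ᶠ β in atTop, a β ≤ K₀ * a' β :=
  ⟨a, 1, ha, hP, one_pos, Eventually.of_forall fun β => by simp⟩

/-- **Domination transfer** (Disproof §1 `concl_of_eventually_le` and §2 `concl_smul_iff` in one step):
clustering in the units of `a'` and `a ≤ K₀ a'` eventually give clustering in the units of `a`, rate `c₁/K₀`. -/
theorem concl_of_dominated (r : LatticeRep G) {a a' : ℝ → ℝ} (h : Concl r a') {K₀ : ℝ} (hK : 0 < K₀)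
    (hdom : ∀ᶠ β in atTop, a β ≤ K₀ * a' β) : Concl r a := by
  obtain ⟨c₁, β₂, S₁, hc, h⟩ := h
  obtain ⟨βs, hβs⟩ := eventually_atTop.1 hdom
  refine ⟨c₁ / K₀, max β₂ βs, S₁, div_pos hc hK, fun A B => ?_⟩
  obtain ⟨C, hC⟩ := h A B
  refine ⟨max C 0, fun β hβ S n hS hn => ?_⟩
  have hβ₂ : β₂ ≤ β := (le_max_left _ _).trans hβ
  have hle : a β ≤ K₀ * a' β := hβs β ((le_max_right _ _).trans hβ)
  refine (hC β hβ₂ S n hS hn).trans ?_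
  have hn0 : (0 : ℝ) ≤ n := Nat.cast_nonneg n
  have key : c₁ / K₀ * a β * n ≤ c₁ * a' β * n := by
    refine mul_le_mul_of_nonneg_right ?_ hn0
    calc c₁ / K₀ * a β ≤ c₁ / K₀ * (K₀ * a' β) := mul_le_mul_of_nonneg_left hle (div_pos hc hK).le
      _ = c₁ / K₀ * K₀ * a' β := by ring
      _ = c₁ * a' β := by rw [div_mul_cancel₀ c₁ hK.ne']
  calc C * Real.exp (-(c₁ * a' β * n)) ≤ max C 0 * Real.exp (-(c₁ * a' β * n)) :=
        mul_le_mul_of_nonneg_right (le_max_left _ _) (Real.exp_pos _).le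
    _ ≤ max C 0 * Real.exp (-(c₁ / K₀ * a β * n)) :=
        mul_le_mul_of_nonneg_left (Real.exp_le_exp.2 (neg_le_neg key)) (le_max_right _ _)

/-- **The pipeline (slab certificate) + S2 + S3 ⇒ `Concl` (the card's constant-slack bookkeeping, PROVED).** With
`q = 1 − 1/K ∈ [0, 1)`, S3 yields a rate `κ > 0` and per-pair constants; S2 turns the slab inequality on `(2S+1)⁴` at
margin `D(β) = ⌈Θ/a β⌉ ≥ 1` into `CondExpDecay`; and `a β ≤ Θ` eventually (THIS is where `Tendsto a atTop (𝓝 0)` of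
the package is load-bearing, Disproof §4) gives `D(β) · a(β) ≤ 2Θ`, hence `κ n / D ≥ (κ/(2Θ)) a(β) n`: the crux's
conclusion with `c₁ = κ/(2Θ)`, S1's `S₁`, `β₂' = max β₂ β_Θ` and `C(A, B) = max C 0`. -/
theorem concl_of_slab (h2 : SlabToDecay) (h3 : DecayToClustering) (r : LatticeRep G) {a : ℝ → ℝ}
    (hpos : ∀ β, 0 < a β) (hlim : Tendsto a atTop (𝓝 0)) {Θ K β₂ : ℝ} {S₁ : ℝ → ℕ} (hΘ : 0 < Θ)
    (hK : 1 ≤ K) (hslab : ∀ β : ℝ, β₂ ≤ β → ∀ S : ℕ, S₁ β ≤ S → SlabInequality r β S ⌈Θ / a β⌉₊ K) :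
    Concl r a := by
  -- the contraction ratio `q = 1 − 1/K ∈ [0, 1)`
  have hK0 : 0 < K := lt_of_lt_of_le one_pos hK
  have hq0 : 0 ≤ 1 - 1 / K := by
    have : 1 / K ≤ 1 := by rw [div_le_one hK0]; exact hK
    linarith
  have hq1 : 1 - 1 / K < 1 := by
    have : 0 < 1 / K := by positivity
    linarith
  obtain ⟨κ, hκ, hAB⟩ := h3 G r (1 - 1 / K) hq0 hq1
  -- `a β < Θ` eventually (Disproof §4: `Tendsto a` is load-bearing exactly here)
  obtain ⟨β₃, hβ₃⟩ := eventually_atTop.1 (hlim (Iio_mem_nhds hΘ))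
  refine ⟨κ / (2 * Θ), max β₂ β₃, S₁, by positivity, fun A B => ?_⟩
  obtain ⟨C, hC⟩ := hAB A B
  refine ⟨max C 0, fun β hβ S n hS hn => ?_⟩
  have hβ2 : β₂ ≤ β := (le_max_left _ _).trans hβ
  have haΘ : a β < Θ := hβ₃ β ((le_max_right _ _).trans hβ)
  have hΘa : 0 < Θ / a β := div_pos hΘ (hpos β)
  have hD1 : 1 ≤ ⌈Θ / a β⌉₊ := Nat.one_le_iff_ne_zero.2 (Nat.ceil_pos.2 hΘa).ne'
  have hdec : CondExpDecay r β S ⌈Θ / a β⌉₊ (1 - 1 / K) :=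
    h2 G r β S ⌈Θ / a β⌉₊ K hD1 hK (hslab β hβ2 S hS)
  refine (hC β S ⌈Θ / a β⌉₊ n hD1 hn hdec).trans ?_
  -- compare the exponents: `κ/(2Θ) · a β · n ≤ κ / ⌈Θ/a β⌉ · n` because `⌈Θ/a β⌉ · a β ≤ 2Θ`
  have hDR : ((⌈Θ / a β⌉₊ : ℕ) : ℝ) < Θ / a β + 1 := Nat.ceil_lt_add_one hΘa.le
  have hDa : ((⌈Θ / a β⌉₊ : ℕ) : ℝ) * a β ≤ 2 * Θ := by
    have h1 : ((⌈Θ / a β⌉₊ : ℕ) : ℝ) * a β < (Θ / a β + 1) * a β := mul_lt_mul_of_pos_right hDR (hpos β)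
    have h2 : (Θ / a β + 1) * a β = Θ + a β := by
      rw [add_mul, one_mul, div_mul_cancel₀ Θ (hpos β).ne']
    linarith
  have hDpos : (0 : ℝ) < ((⌈Θ / a β⌉₊ : ℕ) : ℝ) := by exact_mod_cast hD1
  have hn0 : (0 : ℝ) ≤ n := Nat.cast_nonneg n
  have key : κ / (2 * Θ) * a β * n ≤ κ / (⌈Θ / a β⌉₊ : ℕ) * n := by
    refine mul_le_mul_of_nonneg_right ?_ hn0
    rw [div_mul_eq_mul_div, div_le_div_iff₀ (by positivity) hDpos]
    calc κ * a β * ((⌈Θ / a β⌉₊ : ℕ) : ℝ) = κ * (((⌈Θ / a β⌉₊ : ℕ) : ℝ) * a β) := by ring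
      _ ≤ κ * (2 * Θ) := mul_le_mul_of_nonneg_left hDa hκ.le
  calc C * Real.exp (-(κ / (⌈Θ / a β⌉₊ : ℕ) * n)) ≤ max C 0 * Real.exp (-(κ / (⌈Θ / a β⌉₊ : ℕ) * n)) :=
        mul_le_mul_of_nonneg_right (le_max_left _ _) (Real.exp_pos _).le
    _ ≤ max C 0 * Real.exp (-(κ / (2 * Θ) * a β * n)) :=
        mul_le_mul_of_nonneg_left (Real.exp_le_exp.2 (neg_le_neg key)) (le_max_right _ _)

end Composition

/-- **Final assembly from an S0-shaped witness.** Given, for the ruler `a`, a continuous dominating ruler `a'` with the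
package (what S0 delivers, and the identity delivers for continuous `a`): S1 at `a'` gives the slab certificate,
`concl_of_slab` (S2, S3) clusters in the units of `a'`, and `concl_of_dominated` returns to the units of `a`. -/
theorem concl_of_reduction (h1 : FemtoSlabStub) (h2 : SlabToDecay) (h3 : DecayToClustering)
    {G : Type} [Group G] [TopologicalSpace G] [IsTopologicalGroup G] [CompactSpace G]
    (hG : IsCompactSimpleLieGroup G) :
    letI : MeasurableSpace G := borel G
    haveI : BorelSpace G := ⟨rfl⟩
    ∀ (r : LatticeRep G) (a : ℝ → ℝ),
      (∃ (a' : ℝ → ℝ) (K₀ : ℝ), Continuous a' ∧ Package r a' ∧ 0 < K₀ ∧ ∀ᶠ β in atTop, a β ≤ K₀ * a' β) →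
        Concl r a := by
  letI : MeasurableSpace G := borel G
  haveI : BorelSpace G := ⟨rfl⟩
  intro r a hred
  obtain ⟨a', K₀, ha', hP', hK₀, hdom⟩ := hred
  obtain ⟨Θ, K, β₂, S₁, hΘ, hK, hslab⟩ := h1 G hG r a' ha' hP'
  obtain ⟨Γ, β₀, ℓ₀, c, C, -, -, hpos, hlim, -, -⟩ := hP'
  exact concl_of_dominated r (concl_of_slab h2 h3 r hpos hlim hΘ hK hslab) hK₀ hdom

/-- **S1–S3 prove the repaired crux C′ outright** (S0 replaced by the identity `rulerReduction_of_continuous`): the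
line is a line for C′, as the card and the triage panel say; the typed crux needs S0 on top. -/
theorem cruxRepaired_of_stubs (h1 : FemtoSlabStub) (h2 : SlabToDecay) (h3 : DecayToClustering) :
    CruxRepaired := by
  intro G _ _ _ _ hG
  letI : MeasurableSpace G := borel G
  haveI : BorelSpace G := ⟨rfl⟩
  intro r a ha hP
  exact concl_of_reduction h1 h2 h3 hG r a (rulerReduction_of_continuous r ha hP)

/-- **The reduction statement**: the four stub statements imply the crux (by name). Wrapped in a `def` so that the
only theorem of this file whose stated conclusion is the crux decl is the hypothesis-free `LatticeGapInUVUnits_of`. -/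
def StubsImplyCrux : Prop :=
  RulerReduction → FemtoSlabStub → SlabToDecay → DecayToClustering → LatticeGapInUVUnits

/-- **The composition (kernel-checked, no `sorry`).** S0 hands a continuous dominating ruler with the package;
`concl_of_reduction` does the rest. -/
theorem stubsImplyCrux : StubsImplyCrux := by
  intro h0 h1 h2 h3
  rw [crux_iff]
  intro G _ _ _ _ hG
  letI : MeasurableSpace G := borel G
  haveI : BorelSpace G := ⟨rfl⟩
  intro r a hP
  exact concl_of_reduction h1 h2 h3 hG r a (h0 G hG r a hP)

/-- **The skeleton: the crux BY NAME from the registered stubs** (S0, S1', S1r, S2, S3; its only `sorry`s are the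
open stubs'; the composition `stubsImplyCrux` + `femtoSlabStub_of_stubs` is sorry-free). -/
theorem LatticeGapInUVUnits_of : LatticeGapInUVUnits :=
  stubsImplyCrux stub_rulerReduction femtoSlabStub_of_stubs slabToDecay_of_stub decayToClustering_of_stub

/-! ## §4 The negative side: where the typed defect lives, and checks against the landed Negative lemmas -/

/-- **Any refutation of the typed crux kills the SOCKET, not the line.** If the physics S1 and the engine S2/S3
hold, then `¬ LatticeGapInUVUnits → ¬ RulerReduction`. Instantiate `hneg` with the LANDED negative lemma modulo H,
`Negative.latticeGapInUVUnits_false_of_standardScalingSU hH` (`Theorems/LatticeGapInUVUnits/Negative/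
LatticeGapInUVUnitsFalseOfStandardScalingSU.lean`; cited by name — at publish time the farm reported that module
`remote:stale:unbuilt`, so it is not imported here): in the standard scaling picture of any `SU(N)` the slow step
rulers kill exactly S0, which is why S0 is not staffed and the route owner is asked to restate 9366 as C′
(`cruxRepaired_of_stubs`). -/
theorem not_rulerReduction_of_not_crux (hneg : ¬ LatticeGapInUVUnits) (h1 : FemtoSlabStub) (h2 : SlabToDecay)
    (h3 : DecayToClustering) : ¬ RulerReduction := fun h0 =>
  hneg (stubsImplyCrux h0 h1 h2 h3)

section NegativeChecks

variable {G : Type} [Group G] [TopologicalSpace G] [IsTopologicalGroup G] [CompactSpace G]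
  [MeasurableSpace G] [BorelSpace G]

/-- With rate constant `0` the conclusion shape holds outright for EVERY ruler (Disproof §1 `conclRate_zero`, via the
tree's a-priori bound `abs_latticeConnectedCorr_le` — the same bound that absorbs the short separations in S3): all
content of `Concl` sits in `0 < c₁`, which the pipeline produces as `κ/(2Θ)` from S3's `κ > 0` and S1's `Θ > 0`. -/
example (r : LatticeRep G) (a : ℝ → ℝ) (A B : YMSpecies G) :
    ∃ C : ℝ, ∀ (β : ℝ) (S n : ℕ),
      |latticeConnectedCorr r.ρ β (2 * S + 1) A.F B.F n| ≤ C * Real.exp (-(0 * a β * n)) := by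
  obtain ⟨CA, hCA⟩ := A.bounded
  obtain ⟨CB, hCB⟩ := B.bounded
  refine ⟨2 * (CA * CB), fun β S n => ?_⟩
  simpa using Summit.QuantumFields.YangMills.Theorems.HypercubicLimit.Negative.abs_latticeConnectedCorr_le
    r β (2 * S + 1) hCA hCB n

/-- The uniform-constant strengthening `∃ C ∀ A B` of `Concl` is REFUTED for compact simple `G` (landed
`Negative/UniformConstantFalse.lean`): every `Concl` produced in this file carries S3's PER-PAIR constant
`max C(A,B) 0`, never a uniform one. -/
example (hG : IsCompactSimpleLieGroup G) (r : LatticeRep G) (a : ℝ → ℝ) :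
    ¬ ∃ (c₁ β₂ C : ℝ) (S₁ : ℝ → ℕ), 0 < c₁ ∧ ∀ A B : YMSpecies G, ∀ β : ℝ, β₂ ≤ β → ∀ S n : ℕ,
      S₁ β ≤ S → n ≤ S →
        |latticeConnectedCorr r.ρ β (2 * S + 1) A.F B.F n| ≤ C * Real.exp (-(c₁ * a β * n)) :=
  not_uniform_constant_clustering_of_simple hG r a

/-- For a trivial (subsingleton) gauge group every Wilson expectation is evaluation at the trivial configuration
(Disproof §3; landed as `Negative.wilsonExpectation_eq_apply_one_of_subsingleton`). -/
theorem wilsonExpectation_eq_apply_one_of_subsingleton [Subsingleton G] (r : LatticeRep G) (β : ℝ)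
    (L : ℕ) [NeZero L] (F : GaugeConfig 4 L G → ℝ) :
    wilsonExpectation (d := 4) (L := L) r.ρ β F = F 1 := by
  haveI := isProbabilityMeasure_wilsonMeasure (d := 4) (L := L) r.ρ r.continuous β
  have hF : F = fun _ => F 1 := funext fun U => congrArg F (Subsingleton.elim _ _)
  rw [hF]
  simp [wilsonExpectation]

/-- **No junk regime for the pipeline**: for a subsingleton gauge group the PACKAGE (hypothesis of S0, S1 and of the
crux) is unsatisfiable — the femto lower bound `0 < c Γ(a β) ≤ Cov = 0` fails in the box `L = 8` (Disproof §3
`not_package_of_subsingleton`; landed `Negative.not_femto_lower_bound_of_subsingleton`). So S1 is never instantiated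
where the gauge group is trivial (where `SlabInequality` would hold vacuously with any `K`). -/
theorem not_package_of_subsingleton [Subsingleton G] (r : LatticeRep G) (a : ℝ → ℝ) : ¬ Package r a := by
  rintro ⟨Γ, β₀, ℓ₀, c, C, hℓ, hc, hpos, hlim, hΓ, hbox⟩
  have hev : ∀ᶠ β in atTop, a β < ℓ₀ / 8 := hlim (Iio_mem_nhds (by positivity))
  obtain ⟨β, hβ₀, hβ⟩ := ((eventually_ge_atTop β₀).and hev).exists
  haveI : NeZero (8 : ℕ) := ⟨by norm_num⟩
  have hB : BoxBounds r a Γ c C 8 β := hbox 8 β hβ₀ (by push_cast; linarith)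
  obtain ⟨hax, -⟩ := hB
  have h1 := (hax 1 le_rfl (by norm_num)).1
  simp only [Nat.cast_one, one_mul, one_pow, wilsonExpectation_eq_apply_one_of_subsingleton, sub_self,
    mul_zero] at h1
  have hΓ1 := (hΓ (a β) (hpos β) (by linarith)).1
  nlinarith

/-- **Sanity of the slab vocabulary (degenerate width).** A slab of width `≥ 2S+1` is the whole torus, so an
observable "reading only the slab" is unconstrained; the width hypotheses `w + 2D ≤ 2S` / `w + 2jD ≤ 2S` of
`SlabInequality` / `CondExpDecay` exclude exactly the wrapped slabs, for which "exterior at margin `D`" would be a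
misnomer. -/
example (S : ℕ) (t₀ : ZMod (2 * S + 1)) : slabLinks S t₀ (2 * S + 1) = Set.univ :=
  slabLinks_eq_univ S t₀ le_rfl

end NegativeChecks

/-! ## §5 The flexible form of the residue S1' (lead c1): any margin of physical size `≤ Θ` will do

The slab inequality is MONOTONE in the margin (coarser conditioning leaves a larger residual), so S1' — stated at the
femto margin `⌈Θ/a β⌉` exactly — is EQUIVALENT to its flexible form: a gauge-invariant slab inequality at SOME margin
`D(β) ≥ 2` with `D(β) · a(β) ≤ Θ` (kernel-checked below, `femtoSlabStubGI_iff_flex`). A prover of the promoted item may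
therefore certify whichever margin of physical size `≤ Θ` is convenient; a refuter must beat every such margin. -/

section Flexible

open Summit.QuantumFields.YangMills.Theorems.LatticeGapInUVUnits.FemtoSlabNondegeneracy.GaugeReduction
  (integral_add_sq integral_condExp_mul_eq integrable_of_bdd)

variable {Ω : Type*} {m' m m0 : MeasurableSpace Ω} {μ : Measure Ω} [IsProbabilityMeasure μ] in
/-- **Coarser conditioning leaves a larger residual**: for `m' ≤ m` and bounded measurable `F`,
`∫ (F − μ[F|m])² ≤ ∫ (F − μ[F|m'])²` (`F − P'F = (F − PF) + (PF − P'F)` with the second summand `m`-measurable, hence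
orthogonal to the first). -/
theorem integral_sub_condExp_sq_mono (hm'm : m' ≤ m) (hm : m ≤ m0) {F : Ω → ℝ} (hF : Measurable F) {M : ℝ}
    (hbF : ∀ ω, |F ω| ≤ M) :
    ∫ ω, (F ω - (μ[F|m]) ω) ^ 2 ∂μ ≤ ∫ ω, (F ω - (μ[F|m']) ω) ^ 2 ∂μ := by
  have hFi : Integrable F μ := integrable_of_bdd hF hbF
  have hPb : ∀ᵐ ω ∂μ, |(μ[F|m]) ω| ≤ M := ae_bdd_abs_condExp_of_ae_bdd_abs (ae_of_all _ hbF)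
  have hP'b : ∀ᵐ ω ∂μ, |(μ[F|m']) ω| ≤ M := ae_bdd_abs_condExp_of_ae_bdd_abs (ae_of_all _ hbF)
  have hPm : AEStronglyMeasurable (μ[F|m]) μ := integrable_condExp.aestronglyMeasurable
  have hP'm : AEStronglyMeasurable (μ[F|m']) μ := integrable_condExp.aestronglyMeasurable
  -- a bounded `m`-measurable version `g` of `PF − P'F`
  have hsm : StronglyMeasurable[m] (fun ω => (μ[F|m]) ω - (μ[F|m']) ω) :=
    stronglyMeasurable_condExp.sub (stronglyMeasurable_condExp.mono hm'm)
  obtain ⟨g, hgm, hgb, hg⟩ := exists_stronglyMeasurable_truncation hsm (M + M)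
  have hgae : g =ᵐ[μ] fun ω => (μ[F|m]) ω - (μ[F|m']) ω :=
    (ae_abs_sub_le_add hPb hP'b).mono fun ω hω => hg ω hω
  -- the cross term vanishes
  have hX : ∫ ω, (F ω - (μ[F|m]) ω) * g ω ∂μ = 0 := by
    have a1 : ∫ ω, (μ[F|m]) ω * g ω ∂μ = ∫ ω, F ω * g ω ∂μ := integral_condExp_mul_eq hm hFi hgm hgb
    have hgm0 : AEStronglyMeasurable g μ := (hgm.mono hm).aestronglyMeasurable
    have i1 : Integrable (fun ω => F ω * g ω) μ := by
      simpa only [mul_comm] using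
        Summit.QuantumFields.YangMills.Theorems.LatticeGapInUVUnits.FemtoSlabNondegeneracy.GaugeReduction.integrable_bdd_mul
          hgm0 (ae_of_all _ hgb) hFi
    have i2 : Integrable (fun ω => (μ[F|m]) ω * g ω) μ := by
      simpa only [mul_comm] using
        Summit.QuantumFields.YangMills.Theorems.LatticeGapInUVUnits.FemtoSlabNondegeneracy.GaugeReduction.integrable_bdd_mul
          hgm0 (ae_of_all _ hgb) (integrable_condExp (m := m) (μ := μ) (f := F))
    have e : ∀ ω, (F ω - (μ[F|m]) ω) * g ω = F ω * g ω - (μ[F|m]) ω * g ω := fun ω => by ring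
    simp_rw [e]
    rw [integral_sub i1 i2, a1, sub_self]
  -- expand `∫ (F − P'F)² = ∫ ((F − PF) + g)²`
  have hdecomp : (fun ω => (F ω - (μ[F|m']) ω) ^ 2) =ᵐ[μ] fun ω => ((F ω - (μ[F|m]) ω) + g ω) ^ 2 :=
    hgae.mono fun ω hω => by simp only [hω]; ring
  rw [integral_congr_ae hdecomp, integral_add_sq (u := fun ω => F ω - (μ[F|m]) ω) (v := g)
    (hF.aestronglyMeasurable.sub hPm) (hgm.mono hm).aestronglyMeasurable (M := M + M) (M' := |M + M|)
    (ae_abs_sub_le_add (ae_of_all _ hbF) hPb) (ae_of_all _ hgb), hX]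
  have : 0 ≤ ∫ ω, g ω ^ 2 ∂μ := integral_nonneg fun ω => sq_nonneg _
  linarith

variable {G : Type} [Group G] [TopologicalSpace G] [IsTopologicalGroup G] [CompactSpace G]
  [MeasurableSpace G] [BorelSpace G]

/-- **The gauge-invariant slab inequality is monotone in the margin**: `SlabInequalityGI r β S D K` with `0 ≤ K` implies
`SlabInequalityGI r β S D' K` for every `D' ≥ D` (the exteriors are nested, `slabExterior_anti`, and coarser conditioning
leaves a larger residual, `integral_sub_condExp_sq_mono`). -/
theorem slabInequalityGI_mono (r : LatticeRep G) (β : ℝ) (S : ℕ) {D D' : ℕ} (hDD' : D ≤ D') {K : ℝ} (hK : 0 ≤ K)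
    (h : SlabInequalityGI r β S D K) : SlabInequalityGI r β S D' K := by
  intro t₀ w hw F hFm hFb hFi hFd
  haveI := isProbabilityMeasure_wilsonMeasure (d := 4) (L := 2 * S + 1) r.ρ r.continuous β
  obtain ⟨M, hbF⟩ := hFb
  refine (h t₀ w (by omega) F hFm ⟨M, hbF⟩ hFi hFd).trans (mul_le_mul_of_nonneg_left ?_ hK)
  exact integral_sub_condExp_sq_mono (slabExterior_anti (G := G) S t₀ w hDD') cylinderEvents_le_pi hFm hbF

/-- **The flexible form of S1'**: a gauge-invariant slab inequality at SOME margin `D(β) ≥ 2` of physical size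
`D(β) · a(β) ≤ Θ`, constant `K` uniform in `β`, volume and slab. -/
def FemtoSlabStubGIFlex : Prop :=
  ∀ (G : Type) [Group G] [TopologicalSpace G] [IsTopologicalGroup G] [CompactSpace G],
    IsCompactSimpleLieGroup G →
      letI : MeasurableSpace G := borel G
      haveI : BorelSpace G := ⟨rfl⟩
      ∀ (r : LatticeRep G) (a : ℝ → ℝ), Continuous a → Package r a →
        ∃ (Θ K β₂ : ℝ) (S₁ : ℝ → ℕ) (D : ℝ → ℕ), 0 < Θ ∧ 1 ≤ K ∧
          (∀ β : ℝ, β₂ ≤ β → 2 ≤ D β ∧ (D β : ℝ) * a β ≤ Θ) ∧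
          ∀ β : ℝ, β₂ ≤ β → ∀ S : ℕ, S₁ β ≤ S → SlabInequalityGI r β S (D β) K

/-- **S1' ⇔ its flexible form** (kernel-checked). `⇒`: take `D β = ⌈Θ/a β⌉` beyond the coupling where `a β < Θ`, with
`Θ' = 2Θ`. `⇐`: `D β ≤ Θ/(a β) ≤ ⌈Θ/a β⌉`, and the slab inequality is monotone in the margin. -/
theorem femtoSlabStubGI_iff_flex : FemtoSlabStubGI ↔ FemtoSlabStubGIFlex := by
  constructor
  · intro h G _ _ _ _ hG
    letI : MeasurableSpace G := borel G
    haveI : BorelSpace G := ⟨rfl⟩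
    intro r a ha hP
    obtain ⟨Θ, K, β₂, S₁, hΘ, hK, hslab⟩ := h G hG r a ha hP
    obtain ⟨Γ, β₀, ℓ₀, c, C, -, -, hpos, hlim, -, -⟩ := hP
    obtain ⟨β₃, hβ₃⟩ := eventually_atTop.1 (hlim (Iio_mem_nhds hΘ))
    refine ⟨2 * Θ, K, max β₂ β₃, S₁, fun β => ⌈Θ / a β⌉₊, by positivity, hK, fun β hβ => ?_,
      fun β hβ S hS => hslab β ((le_max_left _ _).trans hβ) S hS⟩
    have haΘ : a β < Θ := hβ₃ β ((le_max_right _ _).trans hβ)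
    have hΘa : 0 < Θ / a β := div_pos hΘ (hpos β)
    refine ⟨Nat.lt_ceil.2 ?_, ?_⟩
    · have h1lt : (1 : ℝ) < Θ / a β := by rw [lt_div_iff₀ (hpos β)]; linarith
      exact_mod_cast h1lt
    · have hDR : ((⌈Θ / a β⌉₊ : ℕ) : ℝ) < Θ / a β + 1 := Nat.ceil_lt_add_one hΘa.le
      have h1 : ((⌈Θ / a β⌉₊ : ℕ) : ℝ) * a β < (Θ / a β + 1) * a β := mul_lt_mul_of_pos_right hDR (hpos β)
      have h2 : (Θ / a β + 1) * a β = Θ + a β := by rw [add_mul, one_mul, div_mul_cancel₀ Θ (hpos β).ne']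
      linarith
  · intro h G _ _ _ _ hG
    letI : MeasurableSpace G := borel G
    haveI : BorelSpace G := ⟨rfl⟩
    intro r a ha hP
    obtain ⟨Θ, K, β₂, S₁, D, hΘ, hK, hD, hslab⟩ := h G hG r a ha hP
    obtain ⟨Γ, β₀, ℓ₀, c, C, -, -, hpos, -, -, -⟩ := hP
    refine ⟨Θ, K, β₂, S₁, hΘ, hK, fun β hβ S hS => ?_⟩
    have hK0 : 0 ≤ K := zero_le_one.trans hK
    refine slabInequalityGI_mono r β S ?_ hK0 (hslab β hβ S hS)
    have hle : (D β : ℝ) ≤ Θ / a β := by rw [le_div_iff₀ (hpos β)]; exact (hD β hβ).2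
    exact Nat.cast_le.1 (hle.trans (Nat.le_ceil _))

end Flexible

end Summit.QuantumFields.YangMills.Cruxes.LatticeGapInUVUnits.FemtoSlabNondegeneracy

end
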